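import Summits.QuantumFields.BalabanUV.T4Continuum.Support.ShellMeasureCommutatorByParts

/-!
# `T4Continuum.ShellMeasureCommutatorGradient` — WALL §2 (a) item (P4), THE ∇-PART (row S65 f3, file 3∕3): THE
# COMMUTATOR TERM's BOND-LOCAL GRADIENT IS `O(d)·|w|·‖τ‖·|A|·|∇A|` — NO BARE `η⁻¹` (cell `pub-balaban`, sub-cell `t4`,
# NE7c (node U5b); unit `b2b-balaban-t4-ne7c-formalise-leaf-05` gen 7; row S65 f3; ADDITIVE — imports file 2
# `ShellMeasureCommutatorByParts` ONLY (hence b08's `B8Eq151V2Divergence`: (1.53) `eq153`, `norm_lin_le(_deriv)`,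
# `norm_sub_sums_le`); [folklore]; 0 def, 0 sorry)

HONEST FRAMING.  Finite four-torus programme, rung (B)+1 only — NOT infinite volume, NOT a mass gap, NOT the Clay
problem, NOT summit progress; (B), `BetaPertHyp`, (B^μ) are not consumed.  NE7c (`T4IndicatorShell.ShellWeightBound`)
is NOT PRINTED and NOT PROVED; «NE7c ⇐ the named binders» (WALL `t4/b2b-balaban-t4-ne7c-p1/WALL-NE7c-P1.md` §2).
ELEMENTARY covariant lattice calculus ([folklore]) over the b08 lineage's KERNEL modules (`B8Ineq132`,
`B8Eq143PlaqExpansion`, `B8Eq146AExpansion`, `B8Eq151V2Divergence`: the covariant derivatives (1.1) = [B9] (3.3)∕(3.8),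
the plaquette covariant derivative [B9] (3.4), the adjoint divergence (1.2) = [B9] (3.9), the bracket `{…}` of (1.49)∕
(1.50), and the kernel theorems (1.50)–(1.53)); [Balaban1985Variational] (cell paper B11) p. 284 (39) and p. 292
(91)–(96) are LOCATORS for the SHAPE only — the paper is under adjudication (ABSOLUTE RULE), nothing printed is asserted
or cited as a fact; no `def … : Prop` is minted (the `def`s are DATA).  HONEST DEPENDENCY (cell): continuum YM on T⁴ ⇐
BetaPertH ∧ nine spine estimates (0/9 proved); BetaPertH ⇐ (D1) ∧ (D4) ∧ CAP+tail; G-an2-4 gates asym, D1 and NE2/3/4.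

THE POINT (owner census gen 29, locator `HOME/b2b-balaban-t4-ne7c-formalise-leaf-02/XREAD-P4-B11-SectB.md` of row S65):
END-II's (P4) binder `hW : ∀ V, Prop4Hyp (W𝒱 V) C₄ a₃` = B11 Prop. 4 (97)∕(98).  At the live levels `Ω_j`, `j ≥ 1`, the
naive one-plaquette Taylor bound «in |A′| alone» loses EXACTLY a factor `Lʲ`, and only where `δ∕δA′(b)` hits the
`(DA′)(p)` slot of (39)'s first term `¼ i tr[(DA)(p)·Σ_{b₁<b₂⊂∂p} i[A′(b₁), A′(b₂)]]`: the single-bond variation of the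
curl is `±η⁻¹R(…)X`, so the naive bound of that slot is `O(1)·η⁻¹·|A′|²`.  Print's repair, p. 292 (93) + [6] (1.52) =
(96): sum by parts — the `η⁻¹` becomes the ADJOINT derivative `D^{η*}` of the bracket, and `D^{η*}{…}` is `O(|A||∇A|)`
by the product rule (1.52) because every term of `{…}` beyond `2[A_μ, A_ν]` CARRIES an `η` ((1.50): «we use these
factors to cancel η⁻¹») — «estimated by O(1)|∇A′||A′|».  This three-file set (`…CommutatorVariation` →
`…CommutatorByParts` → `…CommutatorGradient`) types that MECHANISM at ONE GRID of spacing `η` with the two scales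
DISPLAYED as plain sup bounds `|B(b)| ≤ a`, `|∇^η_{U₀}B| ≤ G` (at level j: `a ∝ (Lʲη)⁻¹`, `G ∝ (Lʲη)⁻²` — the (98)
packaging in the weighted norms is row S65 f2's, not made here).

WHAT THIS FILE PROVES (kernel).  Hypotheses, all DISPLAYED-type and exactly b08's: `0 < η`, `U1`-valued background
(`h₀`), `|B(b)| ≤ a` (`hB`), `|∇^η_{U₀}B| ≤ G` in b08's form `‖covDerivFwd η U₀ κ (B·τ) y‖ ≤ G` (`hG`), traciality of `τ`,
and a finite set `Pl` of increasing plaquettes containing `st(b)`: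
* §1 slot and bracket bounds (`norm_X?_le`, **`norm_dbrk_le`**: `|δ{…}(B)[H]| ≤ 24·a·h`), `norm_plaqCovDeriv_le`
  (`|(D^η_{U₀}B)(p)| ≤ 2G`), `pdiv_sub`, the CRUDE adjoint-derivative bound `norm_covDeriv_le_crude` (`≤ η⁻¹·2M` —
  «D^{1*}_{U₀} … a very simple bounded operator»), `norm_lin_mul_lin_le` (`|(Σᵢxᵢ)²| ≤ 8ηaG` — the square CARRIES an
  `η`), **`norm_pdiv_brk_le`**: `|(D^{η*}_{U₀}{…}_B)_κ(y)| ≤ 80(d − 1)·a·G` (b08's (1.53) `eq153` `64(d−1)aG` for `V₂ =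
  (Σᵢxᵢ)² + {…}` plus `16(d−1)aG` for the square).
* §2 **`norm_sum_dcub_bump_le`** — THE THEOREM: `‖Σ_{p∈Pl} dcub w τ η U₀ B (bump y κ X) p‖ ≤
  176(d − 1)·‖w‖·‖τ‖·a·G·‖X‖` (`80(d−1)` from the summation-by-parts term + `96(d−1)` from the `2(d−1)` star plaquettes,
  each `|DB|·|δ{…}| ≤ 2G·24a‖X‖`) — independent of `#Pl`, of the volume and of `η`; and the derivative form
  **`hasDerivAt_sum_cub_bump_norm_le`** (`∃ δ, HasDerivAt (t ↦ Σ_{p∈Pl} cub(B + t·ι_bX)(p)) δ 0 ∧ ‖δ‖ ≤ …`).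
  CONTRAST (the gain, stated not proved as a lower bound): bounding the summation-by-parts term WITHOUT (1.52), through
  `|(D^η ι_bX)(p)| = η⁻¹‖X‖` and `|{…}| ≤ 12a²`, gives `24(d−1)·|w|‖τ‖·η⁻¹·a²·‖X‖` — the `Lʲ` lost at level j.
NOT HERE (said in every headline): the identification of the cubic commutator functional with the order-3 part of the
actual one-grid Wilson action (row S65 f4, leaf-03: «ord₃ = −½τ(Y·K) + V₀′»), the weighted multi-grid norms and the (98)
packaging (S65 f2a∕f2b, leaf-02), the `HD`-dressed variants `A″ = A′ − HD(A′)` of (91)–(96) with (46)'s second clause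
(S66), the torus packaging, the [dict] (node O); NE7c NOT proved; 0/9 spine.
-/

noncomputable section

open scoped BigOperators
open NormedSpace Finset

namespace Summit.QuantumFields.BalabanUV.T4Continuum.ShellMeasureCommutatorGradient

open Literature.MathematicalPhysics.QuantumFieldTheory.Balaban1983to89
open B7Prop1Explicit (e U1)
open B7Eq78Linearization (conjR conjR_apply conjR_add conjR_sub conjR_smul)
open B8Ineq132 (covDeriv covDerivFwd norm_conjR_le norm_conjR)
open B8Eq143PlaqExpansion (pdiv pdiv_add norm_sub_sums_le)
open B8Eq146AExpansion (X1 X2 X3 X4 lin V2 adR plaqCovDeriv norm_adR_le conjR_neg plaqCovDeriv_eq_covDerivFwd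
  lin_eq_smul_plaqCovDeriv)
open B8Eq151V2Divergence (brk V2_eq_sq_add_brk eq153 norm_lin_le norm_lin_le_deriv norm_covDeriv_eq
  norm_adR_le_of_le)
open ShellMeasureCommutatorVariation ShellMeasureCommutatorByParts

export B7Prop1Explicit (Site)

variable {d : ℕ}

/-! ## §1 Slot, bracket, curl and adjoint-divergence bounds -/

section Bounds

variable {𝔸 : Type*} [NormedRing 𝔸] [NormOneClass 𝔸] [NormedAlgebra ℂ 𝔸]

omit [NormedAlgebra ℂ 𝔸] in
/-- `|x₂(B)| ≤ a` (transport by a `U1` unit is norm-non-increasing). [folklore] -/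
theorem norm_X2_le {U₀ : Site d → Fin d → 𝔸ˣ} (h₀ : ∀ y κ, U₀ y κ ∈ U1 𝔸) {B : Site d → Fin d → 𝔸} {a : ℝ}
    (hB : ∀ y κ, ‖B y κ‖ ≤ a) (μ ν : Fin d) (x : Site d) : ‖X2 U₀ B μ ν x‖ ≤ a :=
  (norm_conjR_le (h₀ x μ) _).trans (hB _ _)

omit [NormedAlgebra ℂ 𝔸] in
/-- `|x₃(B)| ≤ a`. [folklore] -/
theorem norm_X3_le {U₀ : Site d → Fin d → 𝔸ˣ} (h₀ : ∀ y κ, U₀ y κ ∈ U1 𝔸) {B : Site d → Fin d → 𝔸} {a : ℝ}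
    (hB : ∀ y κ, ‖B y κ‖ ≤ a) (μ ν : Fin d) (x : Site d) : ‖X3 U₀ B μ ν x‖ ≤ a :=
  (norm_conjR_le (h₀ x ν) _).trans ((norm_neg _).trans_le (hB _ _))

omit [NormOneClass 𝔸] [NormedAlgebra ℂ 𝔸] in
/-- `|x₄(B)| ≤ a`. [folklore] -/
theorem norm_X4_le {B : Site d → Fin d → 𝔸} {a : ℝ} (hB : ∀ y κ, ‖B y κ‖ ≤ a) (ν : Fin d) (x : Site d) :
    ‖X4 B ν x‖ ≤ a :=
  (norm_neg _).trans_le (hB _ _)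

omit [NormOneClass 𝔸] [NormedAlgebra ℂ 𝔸] in
/-- Six-term triangle inequality. [folklore] -/
theorem norm_add₆_le (A B C D E F : 𝔸) : ‖A + B + C + D + E + F‖ ≤ ‖A‖ + ‖B‖ + ‖C‖ + ‖D‖ + ‖E‖ + ‖F‖ := by
  have h4 : ‖A + B + C + D‖ ≤ ‖A‖ + ‖B‖ + ‖C‖ + ‖D‖ := (norm_add_le _ _).trans (add_le_add norm_add₃_le le_rfl)
  have h5 : ‖A + B + C + D + E‖ ≤ ‖A‖ + ‖B‖ + ‖C‖ + ‖D‖ + ‖E‖ := (norm_add_le _ _).trans (add_le_add h4 le_rfl)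
  exact (norm_add_le _ _).trans (add_le_add h5 le_rfl)

omit [NormedAlgebra ℂ 𝔸] in
/-- THE BRACKET's VARIATION: `|δ{…}(B)[H](p)| ≤ 24·a·h` for `|B| ≤ a`, `|H| ≤ h` (twelve commutators, `2ah` each).
[folklore] -/
theorem norm_dbrk_le {U₀ : Site d → Fin d → 𝔸ˣ} (h₀ : ∀ y κ, U₀ y κ ∈ U1 𝔸) {B H : Site d → Fin d → 𝔸}
    {a h : ℝ} (hB : ∀ y κ, ‖B y κ‖ ≤ a) (hH : ∀ y κ, ‖H y κ‖ ≤ h) (μ ν : Fin d) (x : Site d) :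
    ‖dbrk U₀ B H μ ν x‖ ≤ 24 * a * h := by
  have pair : ∀ {P Q P' Q' : 𝔸}, ‖P‖ ≤ h → ‖Q‖ ≤ a → ‖P'‖ ≤ a → ‖Q'‖ ≤ h →
      ‖adR P Q + adR P' Q'‖ ≤ 4 * a * h := by
    intro P Q P' Q' hP hQ hP' hQ'
    calc ‖adR P Q + adR P' Q'‖ ≤ ‖adR P Q‖ + ‖adR P' Q'‖ := norm_add_le _ _
      _ ≤ 2 * h * a + 2 * a * h := add_le_add (norm_adR_le_of_le hP hQ) (norm_adR_le_of_le hP' hQ')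
      _ = 4 * a * h := by ring
  have b1 := hB x μ
  have b1' := hH x μ
  have b2 := norm_X2_le h₀ hB μ ν x
  have b2' := norm_X2_le h₀ hH μ ν x
  have b3 := norm_X3_le h₀ hB μ ν x
  have b3' := norm_X3_le h₀ hH μ ν x
  have b4 := norm_X4_le hB ν x
  have b4' := norm_X4_le hH ν x
  unfold dbrk
  refine (norm_add₆_le _ _ _ _ _ _).trans ?_
  have t1 := pair b1' b2 b1 b2'
  have t2 := pair b1' b3 b1 b3'
  have t3 := pair b1' b4 b1 b4'
  have t4 := pair b2' b3 b2 b3'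
  have t5 := pair b2' b4 b2 b4'
  have t6 := pair b3' b4 b3 b4'
  unfold X1 at t1 t2 t3 ⊢
  linarith

omit [NormOneClass 𝔸] in
/-- `|(D^η_{U₀}B)(p)| ≤ 2G` for `|∇^η_{U₀}B| ≤ G` (B9 (3.4): `D_μB_ν − D_νB_μ`). [folklore] -/
theorem norm_plaqCovDeriv_le {η : ℝ} {U₀ : Site d → Fin d → 𝔸ˣ} {B : Site d → Fin d → 𝔸} {G : ℝ}
    (hG : ∀ (y : Site d) (κ τ : Fin d), ‖covDerivFwd η U₀ κ (fun z => B z τ) y‖ ≤ G) (μ ν : Fin d)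
    (x : Site d) : ‖plaqCovDeriv η U₀ B μ ν x‖ ≤ 2 * G := by
  rw [plaqCovDeriv_eq_covDerivFwd]
  calc _ ≤ ‖covDerivFwd η U₀ μ (fun y => B y ν) x‖ + ‖covDerivFwd η U₀ ν (fun y => B y μ) x‖ := norm_sub_le _ _
    _ ≤ G + G := add_le_add (hG _ _ _) (hG _ _ _)
    _ = 2 * G := by ring

omit [NormOneClass 𝔸] in
/-- `pdiv` is additive: `D^{η*}(F − G) = D^{η*}F − D^{η*}G` (b08 `pdiv_add`). [folklore] -/
theorem pdiv_sub (η : ℝ) (V : Site d → Fin d → 𝔸ˣ) (F G : Fin d → Fin d → Site d → 𝔸) (μ : Fin d)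
    (x : Site d) : pdiv η V (fun μ ν x => F μ ν x - G μ ν x) μ x = pdiv η V F μ x - pdiv η V G μ x := by
  have hF : F = (fun μ ν x => F μ ν x - G μ ν x) + G := by
    funext μ ν x
    simp
  have h := pdiv_add η V (fun μ ν x => F μ ν x - G μ ν x) G μ x
  rw [← hF] at h
  exact eq_sub_of_add_eq h.symm

/-- THE CRUDE BOUND on the adjoint derivative: `|(D^{η*}_{U₀,ν}F)(x)| ≤ η⁻¹·2M` for `|F| ≤ M` («D^{1*}_{U₀} … is a
very simple bounded operator», B8 p. 85). [folklore] -/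
theorem norm_covDeriv_le_crude {η : ℝ} (hη : 0 < η) {U₀ : Site d → Fin d → 𝔸ˣ} (h₀ : ∀ y κ, U₀ y κ ∈ U1 𝔸)
    {F : Site d → 𝔸} {M : ℝ} (hF : ∀ z, ‖F z‖ ≤ M) (ν : Fin d) (x : Site d) :
    ‖covDeriv η U₀ ν F x‖ ≤ η⁻¹ * (2 * M) := by
  rw [covDeriv, norm_smul, Real.norm_of_nonneg (inv_nonneg.2 hη.le)]
  refine mul_le_mul_of_nonneg_left ?_ (inv_nonneg.2 hη.le)
  calc ‖conjR (U₀ (x - e ν) ν)⁻¹ (F (x - e ν)) - F x‖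
      ≤ ‖conjR (U₀ (x - e ν) ν)⁻¹ (F (x - e ν))‖ + ‖F x‖ := norm_sub_le _ _
    _ ≤ M + M := add_le_add ((norm_conjR_le ((U1 𝔸).inv_mem (h₀ _ _)) _).trans (hF _)) (hF _)
    _ = 2 * M := by ring

/-- `|(Σᵢxᵢ)²(p)| ≤ 8η·a·G` (`|Σᵢxᵢ| ≤ 2ηG` and `≤ 4a`). [folklore] -/
theorem norm_lin_mul_lin_le {η : ℝ} (hη : 0 < η) {U₀ : Site d → Fin d → 𝔸ˣ} (h₀ : ∀ y κ, U₀ y κ ∈ U1 𝔸)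
    {B : Site d → Fin d → 𝔸} {a G : ℝ} (hB : ∀ y κ, ‖B y κ‖ ≤ a)
    (hG : ∀ (y : Site d) (κ τ : Fin d), ‖covDerivFwd η U₀ κ (fun z => B z τ) y‖ ≤ G) (μ ν : Fin d)
    (x : Site d) : ‖lin U₀ B μ ν x * lin U₀ B μ ν x‖ ≤ 8 * η * a * G := by
  have ha : 0 ≤ 4 * a := by linarith [(norm_nonneg _).trans (hB x μ)]
  calc _ ≤ ‖lin U₀ B μ ν x‖ * ‖lin U₀ B μ ν x‖ := norm_mul_le _ _
    _ ≤ (2 * η * G) * (4 * a) :=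
        mul_le_mul (norm_lin_le_deriv hη hG μ ν x) (norm_lin_le h₀ hB μ ν x) (norm_nonneg _)
          ((norm_nonneg _).trans (norm_lin_le_deriv hη hG μ ν x))
    _ = 8 * η * a * G := by ring

/-- THE ADJOINT DIVERGENCE OF THE BRACKET IS `O(a·G)`: `|(D^{η*}_{U₀}{…}_B)_κ(y)| ≤ 80(d − 1)·a·G` — b08's (1.53)
`eq153` (`|D^{η*}V₂| ≤ 64(d−1)aG`, itself (1.51) + the product rule (1.52)) minus the square `(Σᵢxᵢ)²` whose adjoint
divergence is crudely `≤ 16(d−1)aG` because `|Σᵢxᵢ| ≤ 2ηG` CARRIES AN `η`.  No `η⁻¹a²`. [folklore] -/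
theorem norm_pdiv_brk_le {η : ℝ} (hη : 0 < η) {U₀ : Site d → Fin d → 𝔸ˣ} (h₀ : ∀ y κ, U₀ y κ ∈ U1 𝔸)
    {B : Site d → Fin d → 𝔸} {a G : ℝ} (hB : ∀ y κ, ‖B y κ‖ ≤ a)
    (hG : ∀ (y : Site d) (κ τ : Fin d), ‖covDerivFwd η U₀ κ (fun z => B z τ) y‖ ≤ G) (κ : Fin d) (y : Site d) :
    ‖pdiv η U₀ (brk U₀ B) κ y‖ ≤ 80 * ((d : ℝ) - 1) * a * G := by
  have hbrk : brk U₀ B = fun μ ν x => V2 U₀ B μ ν x - lin U₀ B μ ν x * lin U₀ B μ ν x := by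
    funext μ ν x
    exact eq_sub_of_add_eq' (V2_eq_sq_add_brk U₀ B μ ν x).symm
  rw [hbrk, pdiv_sub]
  have h1 := eq153 hη h₀ hB hG κ y
  -- the square: every adjoint derivative of `(Σᵢxᵢ)²` is `≤ η⁻¹·2·(8ηaG) = 16aG`
  have hsq : ∀ (ν μ' ν' : Fin d), ‖covDeriv η U₀ ν (fun z => lin U₀ B μ' ν' z * lin U₀ B μ' ν' z) y‖ ≤ 16 * a * G := by
    intro ν μ' ν'
    refine (norm_covDeriv_le_crude hη h₀ (fun z => norm_lin_mul_lin_le hη h₀ hB hG μ' ν' z) ν y).trans ?_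
    rw [show η⁻¹ * (2 * (8 * η * a * G)) = 16 * a * G * (η⁻¹ * η) by ring, inv_mul_cancel₀ hη.ne', mul_one]
  have h2 : ‖pdiv η U₀ (fun μ ν x => lin U₀ B μ ν x * lin U₀ B μ ν x) κ y‖ ≤ ((d : ℝ) - 1) * (16 * a * G) := by
    unfold pdiv
    exact norm_sub_sums_le (fun ν _ => hsq ν ν κ) (fun ν _ => hsq ν κ ν)
  calc _ ≤ ‖pdiv η U₀ (V2 U₀ B) κ y‖ + ‖pdiv η U₀ (fun μ ν x => lin U₀ B μ ν x * lin U₀ B μ ν x) κ y‖ :=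
        norm_sub_le _ _
    _ ≤ 64 * ((d : ℝ) - 1) * a * G + ((d : ℝ) - 1) * (16 * a * G) := add_le_add h1 h2
    _ = 80 * ((d : ℝ) - 1) * a * G := by ring

/-! ## §2 The theorem -/

/-- **THE ∇-PART: THE COMMUTATOR TERM's BOND-LOCAL GRADIENT IS `O(d)·|w|·‖τ‖·a·G` — NO BARE `η⁻¹`.**  On b08's
`ℤ^d` lattice of spacing `η > 0` with a `U1`-valued background `U₀`, let `|B(b)| ≤ a` and `|∇^η_{U₀}B| ≤ G` (the two
scales displayed as plain sup bounds), `τ` TRACIAL, and `Pl` any finite set of increasing plaquettes containing the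
star of the bond `b = ⟨y, y + e_κ⟩`.  Then the first variation of the cubic commutator functional
`T(B) = Σ_{p ∈ Pl} w·τ((D^η_{U₀}B)(p)·{…}_B(p))` in the single-bond direction `ι_bX` obeys
`|δ_b T[X]| ≤ 176(d − 1)·|w|·‖τ‖·a·G·‖X‖` — `80(d−1)` from the adjoint divergence of the bracket (summation by
parts + (1.52)∕(1.53)) and `96(d−1)` from the `2(d−1)` plaquettes of the star (`|DB| ≤ 2G` times `|δ{…}| ≤ 24a‖X‖`);
independent of `#Pl`, of the volume and of `η`.  [Balaban1985Variational] (91)–(96) TYPE («estimated by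
O(1)|∇A′||A′|») — LOCATOR ONLY. [folklore] -/
theorem norm_sum_dcub_bump_le {η : ℝ} (hη : 0 < η) {U₀ : Site d → Fin d → 𝔸ˣ} (h₀ : ∀ y κ, U₀ y κ ∈ U1 𝔸)
    {B : Site d → Fin d → 𝔸} {a G : ℝ} (hB : ∀ y κ, ‖B y κ‖ ≤ a)
    (hG : ∀ (y : Site d) (κ τ : Fin d), ‖covDerivFwd η U₀ κ (fun z => B z τ) y‖ ≤ G)
    (w : ℂ) {tr : 𝔸 →L[ℂ] ℂ} (htr : ∀ P Q : 𝔸, tr (P * Q) = tr (Q * P))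
    {Pl : Finset (Fin d × Fin d × Site d)} {y : Site d} {κ : Fin d} (hst : plaqStar y κ ⊆ Pl)
    (hincr : ∀ p ∈ Pl, p.1 < p.2.1) (X : 𝔸) :
    ‖∑ p ∈ Pl, dcub w tr η U₀ B (bump y κ X) p.1 p.2.1 p.2.2‖ ≤
      176 * ((d : ℝ) - 1) * ‖w‖ * ‖tr‖ * a * G * ‖X‖ := by
  have ha : 0 ≤ a := (norm_nonneg _).trans (hB y κ)
  have hGnn : 0 ≤ G := (norm_nonneg _).trans (hG y κ κ)
  have hd : 0 ≤ (d : ℝ) - 1 := by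
    have : 1 ≤ d := Nat.succ_le_of_lt (Fin.pos κ)
    have : (1 : ℝ) ≤ d := by exact_mod_cast this
    linarith
  -- (i) restrict to the star
  rw [sum_eq_sum_plaqStar hst hincr fun p _ hlt hps => dcub_bump_eq_zero w tr η U₀ B hlt hps X]
  -- (ii) split the first variation into its two terms
  have hsplit : ∀ p : Fin d × Fin d × Site d, dcub w tr η U₀ B (bump y κ X) p.1 p.2.1 p.2.2 =
      w * tr (plaqCovDeriv η U₀ (bump y κ X) p.1 p.2.1 p.2.2 * brk U₀ B p.1 p.2.1 p.2.2)
        + w * tr (plaqCovDeriv η U₀ B p.1 p.2.1 p.2.2 * dbrk U₀ B (bump y κ X) p.1 p.2.1 p.2.2) := by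
    intro p
    rw [dcub, map_add, mul_add]
  rw [sum_congr rfl fun p _ => hsplit p, sum_add_distrib, ← mul_sum,
    sum_plaqStar_tr_plaqCovDeriv_bump η htr U₀ (brk U₀ B) y κ X]
  -- (iii) the summation-by-parts term
  have t1 : ‖w * tr (X * pdiv η U₀ (brk U₀ B) κ y)‖ ≤ ‖w‖ * ‖tr‖ * (80 * ((d : ℝ) - 1) * a * G) * ‖X‖ := by
    rw [norm_mul]
    have h := (tr.le_opNorm _).trans (mul_le_mul_of_nonneg_left
      ((norm_mul_le _ _).trans (mul_le_mul_of_nonneg_left (norm_pdiv_brk_le hη h₀ hB hG κ y) (norm_nonneg X)))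
      (norm_nonneg tr))
    calc ‖w‖ * ‖tr (X * pdiv η U₀ (brk U₀ B) κ y)‖ ≤ ‖w‖ * (‖tr‖ * (‖X‖ * (80 * ((d : ℝ) - 1) * a * G))) :=
          mul_le_mul_of_nonneg_left h (norm_nonneg w)
      _ = ‖w‖ * ‖tr‖ * (80 * ((d : ℝ) - 1) * a * G) * ‖X‖ := by ring
  -- (iv) the star term: `2(d−1)` plaquettes, each `≤ |w|‖τ‖·2G·24a‖X‖`
  have hX : ∀ y' κ', ‖bump y κ X y' κ'‖ ≤ ‖X‖ := fun y' κ' => norm_bump_le y y' κ κ' X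
  have t2' : ∀ p ∈ plaqStar y κ, ‖w * tr (plaqCovDeriv η U₀ B p.1 p.2.1 p.2.2 * dbrk U₀ B (bump y κ X) p.1 p.2.1 p.2.2)‖
      ≤ ‖w‖ * ‖tr‖ * (2 * G) * (24 * a * ‖X‖) := by
    intro p _
    rw [norm_mul]
    have h : ‖tr (plaqCovDeriv η U₀ B p.1 p.2.1 p.2.2 * dbrk U₀ B (bump y κ X) p.1 p.2.1 p.2.2)‖
        ≤ ‖tr‖ * (2 * G * (24 * a * ‖X‖)) :=
      (tr.le_opNorm _).trans (mul_le_mul_of_nonneg_left ((norm_mul_le _ _).trans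
        (mul_le_mul (norm_plaqCovDeriv_le hG p.1 p.2.1 p.2.2) (norm_dbrk_le h₀ hB hX p.1 p.2.1 p.2.2)
          (norm_nonneg _) (by positivity))) (norm_nonneg tr))
    calc _ ≤ ‖w‖ * (‖tr‖ * (2 * G * (24 * a * ‖X‖))) := mul_le_mul_of_nonneg_left h (norm_nonneg w)
      _ = _ := by ring
  have t2 : ‖∑ p ∈ plaqStar y κ, w * tr (plaqCovDeriv η U₀ B p.1 p.2.1 p.2.2
      * dbrk U₀ B (bump y κ X) p.1 p.2.1 p.2.2)‖ ≤ 96 * ((d : ℝ) - 1) * ‖w‖ * ‖tr‖ * a * G * ‖X‖ := by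
    refine (norm_sum_le_of_le _ t2').trans ?_
    rw [sum_const, nsmul_eq_mul]
    have hc := card_plaqStar_le y κ
    have hnn : 0 ≤ ‖w‖ * ‖tr‖ * (2 * G) * (24 * a * ‖X‖) := by positivity
    nlinarith
  calc _ ≤ ‖w * tr (X * pdiv η U₀ (brk U₀ B) κ y)‖ + ‖∑ p ∈ plaqStar y κ, w * tr (plaqCovDeriv η U₀ B p.1 p.2.1 p.2.2
        * dbrk U₀ B (bump y κ X) p.1 p.2.1 p.2.2)‖ := norm_add_le _ _
    _ ≤ ‖w‖ * ‖tr‖ * (80 * ((d : ℝ) - 1) * a * G) * ‖X‖ + 96 * ((d : ℝ) - 1) * ‖w‖ * ‖tr‖ * a * G * ‖X‖ :=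
        add_le_add t1 t2
    _ = 176 * ((d : ℝ) - 1) * ‖w‖ * ‖tr‖ * a * G * ‖X‖ := by ring

/-- **THE SAME AS A DERIVATIVE STATEMENT** (B11's `(δ∕δA(b))` of the cubic term): the directional derivative at
`t = 0` of `t ↦ Σ_{p∈Pl} cub(B + t·ι_bX)(p)` exists, equals `Σ_{p∈Pl} dcub(B)[ι_bX](p)`, and is bounded by
`176(d − 1)·|w|·‖τ‖·a·G·‖X‖`. [folklore] -/
theorem hasDerivAt_sum_cub_bump_norm_le {η : ℝ} (hη : 0 < η) {U₀ : Site d → Fin d → 𝔸ˣ}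
    (h₀ : ∀ y κ, U₀ y κ ∈ U1 𝔸) {B : Site d → Fin d → 𝔸} {a G : ℝ} (hB : ∀ y κ, ‖B y κ‖ ≤ a)
    (hG : ∀ (y : Site d) (κ τ : Fin d), ‖covDerivFwd η U₀ κ (fun z => B z τ) y‖ ≤ G)
    (w : ℂ) {tr : 𝔸 →L[ℂ] ℂ} (htr : ∀ P Q : 𝔸, tr (P * Q) = tr (Q * P))
    {Pl : Finset (Fin d × Fin d × Site d)} {y : Site d} {κ : Fin d} (hst : plaqStar y κ ⊆ Pl)
    (hincr : ∀ p ∈ Pl, p.1 < p.2.1) (X : 𝔸) :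
    ∃ δ : ℂ, HasDerivAt (fun t : ℂ => ∑ p ∈ Pl, cub w tr η U₀ (B + t • bump y κ X) p.1 p.2.1 p.2.2) δ 0 ∧
      ‖δ‖ ≤ 176 * ((d : ℝ) - 1) * ‖w‖ * ‖tr‖ * a * G * ‖X‖ :=
  ⟨_, hasDerivAt_sum_cub Pl w tr η U₀ B (bump y κ X), norm_sum_dcub_bump_le hη h₀ hB hG w htr hst hincr X⟩

end Bounds

end Summit.QuantumFields.BalabanUV.T4Continuum.ShellMeasureCommutatorGradient

end
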